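import Literature.MathematicalPhysics.QuantumFieldTheory.WilsonTransferKernel
import Literature.MathematicalPhysics.QuantumLattice.GaugeGroups
import HarnessLib

/-!
# Stub `stub_timeSlicing` (T1) for the crux `WeakCouplingHypercubicLimit` (line `Sketch`)

Slicing Wilson's lattice gauge theory on the torus `(ℤ/N)⁴` across the Euclidean time direction `0`
(Osterwalder–Seiler 1978 §2; Seiler LNP 159 Ch. 2).  A configuration `U : GaugeConfig 4 N G` is
assembled from its time slices `Us t : GaugeConfig 3 N G` (spatial links,
`U((t, x⃗), i.succ) = Us t (x⃗, i)`) and temporal links `gs t : Site 3 N → G` (`U((t, x⃗), 0) = gs t x⃗`),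
time being coordinate `0` and `x⃗ = Fin.tail x`:

* (a) the assembling map is measurable and pushes the product of the slice Haar probability measures
  forward to the product Haar measure of the torus: both are products of normalised Haar measures
  over the same links, regrouped along `Edge 4 N ≃ ZMod N × (Edge 3 N ⊕ Site 3 N)`
  (`Measure.pi_eq` on boxes, `prod_edge_succ`);
* (b) the Wilson action splits as `Σ_t [S₃(Us t) + S_tm(Us t, gs t, Us (t+1))]`: at a site
  `x = Fin.cons t y` the plaquettes in the planes `(i.succ, j.succ)` are the spatial plaquettes of the
  slice `t` at `y` (`wilsonAction (d := 3)`), those in the planes `(0, j.succ)` are the temporal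
  plaquettes between the slices `t` and `t + 1` (`sliceTemporalAction`).

Template: `Literature/MathematicalPhysics/QuantumFieldTheory/SlabTransferKernel.lean`
(`map_assemble_eq_haar`, `weight_assemble_eq_prod`).
-/

noncomputable section

open scoped BigOperators
open MeasureTheory
open Literature.MathematicalPhysics.QuantumFieldTheory

namespace Summit.QuantumFields.YangMills.Theorems.WeakCouplingHypercubicLimit.TraceNormColdPressure

/-! ### Tuple bookkeeping: sites `Fin.cons t y` of the torus `(ℤ/N)^{d+1}` -/

/-- Shifting the site `Fin.cons t y` in the time direction `0` shifts its time coordinate. [folklore] -/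
private theorem cons_add_single_zero {N d : ℕ} (t : ZMod N) (y : Fin d → ZMod N) :
    (Fin.cons t y : Fin (d + 1) → ZMod N) + Pi.single 0 1 = Fin.cons (t + 1) y := by
  ext j
  refine Fin.cases ?_ (fun k => ?_) j
  · simp
  · simp

/-- Shifting the site `Fin.cons t y` in the spatial direction `i.succ` shifts its spatial part in the
direction `i`. [folklore] -/
private theorem cons_add_single_succ {N d : ℕ} (t : ZMod N) (y : Fin d → ZMod N) (i : Fin d) :
    (Fin.cons t y : Fin (d + 1) → ZMod N) + Pi.single i.succ 1 = Fin.cons t (y + Pi.single i 1) := by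
  ext j
  refine Fin.cases ?_ (fun k => ?_) j
  · simp
  · simp [Pi.single_apply]

/-- Reindexing a sum over `Fin (d + 1) → α` by (first coordinate, tail). [folklore] -/
private theorem sum_site_succ {α M : Type*} [Fintype α] [AddCommMonoid M] {d : ℕ}
    (F : (Fin (d + 1) → α) → M) :
    ∑ x, F x = ∑ t : α, ∑ y : Fin d → α, F (Fin.cons t y) := by
  rw [← Fintype.sum_prod_type']
  exact (Fintype.sum_equiv (Fin.consEquiv fun _ : Fin (d + 1) => α) _ _ fun _ => rfl).symm

/-- Reindexing a product over `Fin (d + 1) → α` by (first coordinate, tail). [folklore] -/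
private theorem prod_site_succ {α M : Type*} [Fintype α] [CommMonoid M] {d : ℕ}
    (F : (Fin (d + 1) → α) → M) :
    ∏ x, F x = ∏ t : α, ∏ y : Fin d → α, F (Fin.cons t y) := by
  rw [← Fintype.prod_prod_type']
  exact (Fintype.prod_equiv (Fin.consEquiv fun _ : Fin (d + 1) => α) _ _ fun _ => rfl).symm

/-- Regrouping a product over the positively oriented edges of the torus `(ℤ/N)^{d+1}` by the time
coordinate of the base point and by spatial (`i.succ`) versus temporal (`0`) direction. [folklore] -/
private theorem prod_edge_succ {N d : ℕ} [NeZero N] {M : Type*} [CommMonoid M]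
    (f : Edge (d + 1) N → M) :
    ∏ e, f e = (∏ t : ZMod N, ∏ q : Edge d N, f (Fin.cons t q.1, q.2.succ)) *
      ∏ t : ZMod N, ∏ y : Site d N, f (Fin.cons t y, 0) := by
  rw [Fintype.prod_prod_type, prod_site_succ]
  simp only [Fintype.prod_prod_type]
  rw [← Finset.prod_mul_distrib]
  refine Finset.prod_congr rfl fun t _ => ?_
  rw [← Finset.prod_mul_distrib]
  refine Finset.prod_congr rfl fun y _ => ?_
  rw [Fin.prod_univ_succ, mul_comm]

/-! ### Plaquette bookkeeping -/

/-- The Wilson action as a sum over sites and ordered pairs of directions. [folklore] -/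
private theorem wilsonAction_eq_sum_ite {d L n : ℕ} [NeZero L] {G : Type*} [Group G]
    (ρ : G →* Matrix (Fin n) (Fin n) ℂ) (U : GaugeConfig d L G) :
    wilsonAction ρ U = ∑ x : Site d L, ∑ a : Fin d, ∑ b : Fin d,
      if a < b then ((n : ℝ) - (ρ (plaquetteHolonomy U x a b)).trace.re) else 0 := by
  unfold wilsonAction
  rw [Fintype.sum_prod_type]
  refine Finset.sum_congr rfl fun x _ => ?_
  dsimp only
  rw [← Finset.sum_subtype (p := fun pr : Fin d × Fin d => pr.1 < pr.2)
      (Finset.univ.filter fun pr : Fin d × Fin d => pr.1 < pr.2) (fun _ => by simp)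
      (fun pr : Fin d × Fin d => (n : ℝ) - (ρ (plaquetteHolonomy U x pr.1 pr.2)).trace.re),
    Finset.sum_filter, Fintype.sum_prod_type]

/-- Splitting the sum over ordered pairs of directions of `Fin (d + 1)` into the temporal pairs
`(0, j.succ)` and the spatial pairs `(i.succ, j.succ)`. [folklore] -/
private theorem sum_sum_ite_lt_succ {M : Type*} [AddCommMonoid M] {d : ℕ}
    (g : Fin (d + 1) → Fin (d + 1) → M) :
    (∑ a, ∑ b, if a < b then g a b else 0) =
      (∑ j : Fin d, g 0 j.succ) + ∑ i : Fin d, ∑ j : Fin d, if i < j then g i.succ j.succ else 0 := by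
  rw [Fin.sum_univ_succ, Fin.sum_univ_succ]
  simp only [lt_self_iff_false, if_false, zero_add, Fin.succ_pos, if_true]
  congr 1
  refine Finset.sum_congr rfl fun i _ => ?_
  rw [Fin.sum_univ_succ]
  simp only [Fin.not_lt_zero, if_false, zero_add, Fin.succ_lt_succ_iff]

/-! ### The assembling map -/

/-- Assembling a configuration of the four-torus from its time slices is measurable. [folklore] -/
private theorem measurable_timeAssemble {N : ℕ} {G : Type} [MeasurableSpace G] :
    Measurable fun p : (ZMod N → GaugeConfig 3 N G) × (ZMod N → Site 3 N → G) => fun e : Edge 4 N =>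
      (Fin.cons (p.2 (e.1 0) (Fin.tail e.1)) (fun i : Fin 3 => p.1 (e.1 0) (Fin.tail e.1, i)) :
        Fin 4 → G) e.2 := by
  refine measurable_pi_lambda _ fun e => ?_
  refine Fin.cases ?_ (fun i => ?_) e.2
  · simp only [Fin.cons_zero]
    exact (measurable_pi_apply _).comp ((measurable_pi_apply _).comp measurable_snd)
  · simp only [Fin.cons_succ]
    exact (measurable_pi_apply _).comp ((measurable_pi_apply _).comp measurable_fst)

/-- The preimage of a box of link sets under assembling is a product of boxes of slices. [folklore] -/
private theorem preimage_timeAssemble_pi {N : ℕ} {G : Type} (s : Edge 4 N → Set G) :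
    (fun p : (ZMod N → GaugeConfig 3 N G) × (ZMod N → Site 3 N → G) => fun e : Edge 4 N =>
        (Fin.cons (p.2 (e.1 0) (Fin.tail e.1)) (fun i : Fin 3 => p.1 (e.1 0) (Fin.tail e.1, i)) :
          Fin 4 → G) e.2) ⁻¹' Set.pi Set.univ s =
      (Set.pi Set.univ fun t : ZMod N => Set.pi Set.univ fun q : Edge 3 N =>
          s ((Fin.cons t q.1 : Site 4 N), q.2.succ)) ×ˢ
        (Set.pi Set.univ fun t : ZMod N => Set.pi Set.univ fun y : Site 3 N =>
          s ((Fin.cons t y : Site 4 N), 0)) := by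
  ext p
  simp only [Set.mem_preimage, Set.mem_pi, Set.mem_univ, true_implies, Set.mem_prod]
  constructor
  · intro h
    refine ⟨fun t q => ?_, fun t y => ?_⟩
    · simpa only [Fin.cons_zero, Fin.tail_cons, Fin.cons_succ, Prod.mk.eta] using
        h (Fin.cons t q.1, q.2.succ)
    · simpa only [Fin.cons_zero, Fin.tail_cons] using h (Fin.cons t y, 0)
  · rintro ⟨h1, h2⟩ ⟨x, μ⟩
    refine Fin.cases ?_ (fun i => ?_) μ
    · simpa only [Fin.cons_self_tail, Fin.cons_zero] using h2 (x 0) (Fin.tail x)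
    · simpa only [Fin.cons_self_tail, Fin.cons_succ] using h1 (x 0) (Fin.tail x, i)

/-- Assembling pushes the product of the slice Haar measures forward to the Haar measure of the
four-torus (`Measure.pi_eq` on boxes; cf. `SlabTransferKernel.map_assemble_eq_haar`). [folklore] -/
private theorem map_timeAssemble_eq_pi (N : ℕ) [NeZero N] (G : Type) [Group G] [TopologicalSpace G]
    [IsTopologicalGroup G] [CompactSpace G] [MeasurableSpace G] [BorelSpace G] :
    Measure.map (fun p : (ZMod N → GaugeConfig 3 N G) × (ZMod N → Site 3 N → G) =>
        fun e : Edge 4 N =>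
          (Fin.cons (p.2 (e.1 0) (Fin.tail e.1)) (fun i : Fin 3 => p.1 (e.1 0) (Fin.tail e.1, i)) :
            Fin 4 → G) e.2)
        ((Measure.pi fun _ : ZMod N => Measure.pi fun _ : Edge 3 N => haarProbability G).prod
          (Measure.pi fun _ : ZMod N => Measure.pi fun _ : Site 3 N => haarProbability G)) =
      Measure.pi fun _ : Edge 4 N => haarProbability G := by
  symm
  refine Measure.pi_eq fun s hs => ?_
  rw [Measure.map_apply measurable_timeAssemble (MeasurableSet.univ_pi hs),
    preimage_timeAssemble_pi, Measure.prod_prod, Measure.pi_pi, Measure.pi_pi, prod_edge_succ]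
  simp only [Measure.pi_pi]

/-! ### The stub -/

/-- `stub_timeSlicing` (T1) — **slicing the four-torus across Euclidean time** (Osterwalder–Seiler
1978 §2; Seiler LNP 159 Ch. 2).  A configuration `U : GaugeConfig 4 N G` of the torus `(ℤ/N)⁴` is
assembled from its time slices — spatial links `Us t : GaugeConfig 3 N G`
(`U((t, x⃗), i.succ) = Us t (x⃗, i)`) and temporal links `gs t : Site 3 N → G` (`U((t, x⃗), 0) = gs t x⃗`),
time being coordinate `0` and `x⃗ = Fin.tail x`; (a) assembling is measure-preserving from the product
of the slice Haar probability measures to the Haar measure of the torus; (b) Wilson's action is the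
sum over slices of the spatial plaquette energy `wilsonAction (d := 3)` of each slice and the temporal
plaquette energy `sliceTemporalAction` between consecutive slices. [folklore] -/
theorem stub_timeSlicing :
    ∀ (N : ℕ) [NeZero N] (G : Type) [Group G] [TopologicalSpace G] [IsTopologicalGroup G] [CompactSpace G]
      [MeasurableSpace G] [BorelSpace G] {n : ℕ} (ρ : G →* Matrix (Fin n) (Fin n) ℂ),
    MeasurePreserving
        (fun p : (ZMod N → GaugeConfig 3 N G) × (ZMod N → Site 3 N → G) => fun e : Edge 4 N =>
          (Fin.cons (p.2 (e.1 0) (Fin.tail e.1)) (fun i : Fin 3 => p.1 (e.1 0) (Fin.tail e.1, i)) : Fin 4 → G) e.2)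
        ((Measure.pi fun _ : ZMod N => Measure.pi fun _ : Edge 3 N => haarProbability G).prod
          (Measure.pi fun _ : ZMod N => Measure.pi fun _ : Site 3 N => haarProbability G))
        (Measure.pi fun _ : Edge 4 N => haarProbability G) ∧
      ∀ (Us : ZMod N → GaugeConfig 3 N G) (gs : ZMod N → Site 3 N → G),
        wilsonAction ρ (fun e : Edge 4 N =>
            (Fin.cons (gs (e.1 0) (Fin.tail e.1)) (fun i : Fin 3 => Us (e.1 0) (Fin.tail e.1, i)) : Fin 4 → G) e.2) =
          ∑ t : ZMod N, (wilsonAction ρ (Us t) + sliceTemporalAction ρ (Us t) (gs t) (Us (t + 1))) := by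
  intro N _ G _ _ _ _ _ _ n ρ
  refine ⟨⟨measurable_timeAssemble, map_timeAssemble_eq_pi N G⟩, fun Us gs => ?_⟩
  rw [wilsonAction_eq_sum_ite, sum_site_succ]
  refine Finset.sum_congr rfl fun t _ => ?_
  rw [wilsonAction_eq_sum_ite, sliceTemporalAction, ← Finset.sum_add_distrib]
  refine Finset.sum_congr rfl fun y _ => ?_
  rw [sum_sum_ite_lt_succ, add_comm]
  simp only [plaquetteHolonomy, Site.shift, cons_add_single_zero, cons_add_single_succ, Fin.cons_zero,
    Fin.cons_succ, Fin.tail_cons]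

end Summit.QuantumFields.YangMills.Theorems.WeakCouplingHypercubicLimit.TraceNormColdPressure

end
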